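import Summits.ResolutionOfSingularities.ResolutionOfSingularities.Theorems.PurelyInseparableDim4ResConeLightTailThreeFive
import Summits.ResolutionOfSingularities.ResolutionOfSingularities.Theorems.PurelyInseparableDim4ResConeTwoSlotFlag
import Summits.ResolutionOfSingularities.ResolutionOfSingularities.Theorems.PurelyInseparableDim4ResConeSliceA
import Summits.ResolutionOfSingularities.ResolutionOfSingularities.Theorems.PurelyInseparableDim4TschirnhausJetStep
import HarnessLib
import HarnessLib.Audit.Tags

/-!
# Purely inseparable four-folds — TWO-SLOT GAME, THE BOUNDARY OF A SLOT TAIL: along a two-slot tail without rotation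
# the boundary is frozen, nothing on it is translated, the four letters are fixed, and the T-sector persists
# (cell `res-dim4-pi`, K2(p) lane, slice B brick K24a, part γ, file 1 of 2)

[OURS · counted 0 · cell `res-dim4-pi` · K2(p) lane (holder res-dim4-p-12 g3, «p-1 takes K24a» 2026-08-29
01:14Z; statement layer 01:24Z, stub γ); seat res-dim4-p-1 g4.]  Nothing here proves K2(p)/K2(5),
`NoIsolatedTrap p p` or resolution of singularities in dimension ≥ 4 / characteristic `p`.  AI kernel work, weaker
than expert review.

THE REGIME.  (T2) of K26b `light_tail_trichotomy` at `p = 5`, `d = 3` (weights `≤ 1`, `|r| = 3` by K26a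
`light_weights`): an idle boundary letter `ν` and, from `k₁` on, SLOT STEPS only — NO ROTATION, `1 ≤ r_k (j k)` (the
rotation steps `j k` = the free letter are β4-F's declared gap).  This file is the bookkeeping of that regime:

* §1 `r_succ_eq_of_slot` — one slot step of a weight-`1` boundary of constant size keeps the boundary and translates
  no boundary letter (`r′ = (r.filter (b = 0)).update j 1`, p-9's `step_r_univ'`, and `|r′| = |r|`);
  **`boundary_frozen`** — hence `r_k = r_{k₁}` and `b k i = 0` on `supp r` for all `k ≥ k₁`.
* §2 `exists_slot_letters` — a weight-`1` boundary of size `3` containing `ν` is `e_A + e_B + e_ν` for two SLOT letters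
  `A ≠ B` and a FREE letter `f`, all four distinct; `chart_mem_slots` — every chart from `k₁` on is `A` or `B`;
  `translation_eq_single` — every translation is `β_k·e_f`.
* §3 `tSector_persists` — if the vertex form charges the free letter at `k₁` (`ℓ_{k₁} f ≠ 0`, the T-sector) it does so
  for ever (`ℓ_{k+1} f = λ_k ℓ_k f`, `f` is never the chart); `translation_eq_neg_div` — the direction equation then
  reads `β_k = −ℓ_k (j k) / ℓ_k f`.

Part 2 (`…ResConeTwoSlotTail`): canonical frames at every stage, the readings, the game, the free-tail theorem.
[cite: CossartJannsenSaito2020, Thm. 3.14, Thm. 9.3] bears_on: LADDER-RESOLUTION:D157-DOOR2 (res-dim4-pi · K2(p) ·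
slice B · K24a-γ).  Supports stmt-ResolutionOfSingularities-16155 (helper).
-/

set_option linter.dupNamespace false -- mandated namespace of this single-conjunct summit

noncomputable section

namespace Summit.ResolutionOfSingularities.ResolutionOfSingularities.Theorems.PIDim4

namespace ResCone

open MvPolynomial Finset
open Literature.AlgebraicGeometry.Resolution
open Literature.AlgebraicGeometry.Resolution.CentreBlowup
open Literature.AlgebraicGeometry.Resolution.Hauser2010
open Literature.AlgebraicGeometry.Resolution.HauserPerlega2019

variable {K : Type} [Field K]

/-! ## 1. The boundary is frozen -/

section Frozen

variable [DecidableEq K]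

/-- **One slot step keeps a boundary of constant size**: on a witnessed chain, if `ord₀ F_k = q + 1` (new weight
`1`), the chart letter has weight `1` and `|r_{k+1}| = |r_k|`, then `r_{k+1} = r_k` and no boundary letter is
translated. [folklore] [cite: HauserPerlega2019PRIMS, §2 (transform D' of D)] -/
theorem r_succ_eq_of_slot (q : ℕ) {c : ℕ → State K} {j : ℕ → Fin 4} {b : ℕ → Fin 4 → K}
    (hw : FreeTail.IsWitnessedChain q c j b) {k : ℕ} (ho : ordZero (c k).F = ((q + 1 : ℕ) : ℕ∞))
    (hdeg : (c (k + 1)).r.degree = (c k).r.degree) (hslot : (c k).r (j k) = 1) :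
    (c (k + 1)).r = (c k).r ∧ ∀ i, (c k).r i ≠ 0 → b k i = 0 := by
  have hbj : b k (j k) = 0 := (hw k).2.1
  have hck : c (k + 1) = CentreBlowup.step q Finset.univ (j k) (b k) (c k) := (hw k).2.2.2.2
  set P : ℕ → Fin 4 →₀ ℕ := fun _ => (c k).r.filter (fun i => b k i = 0) with hP
  have hfj : ((c k).r.filter (fun i => b k i = 0)) (j k) = 1 := by
    rw [Finsupp.filter_apply, if_pos hbj, hslot]
  have hr' : (c (k + 1)).r = (c k).r.filter (fun i => b k i = 0) := by
    rw [hck, step_r_univ' q (j k) (b k) (c k) ho, show q + 1 - q = 1 by omega, ← hfj, Finsupp.update_self]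
  have hle : (c k).r.filter (fun i => b k i = 0) ≤ (c k).r := fun i => by
    rw [Finsupp.filter_apply]; split_ifs <;> simp
  have heq : (c k).r.filter (fun i => b k i = 0) = (c k).r :=
    FrameChange.eq_of_le_of_degree_le hle (by rw [← hr', hdeg])
  refine ⟨by rw [hr', heq], fun i hi => ?_⟩
  by_contra hb
  have h := DFunLike.congr_fun heq i
  rw [Finsupp.filter_apply, if_neg hb] at h
  exact hi h.symm

/-- **THE BOUNDARY OF A SLOT TAIL IS FROZEN**: along a witnessed chain with `ord₀ ≡ q + 1`, `|r| ≡ D`, weights `≤ 1`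
and slot steps only (`1 ≤ r_k (j k)`) from `k₁` on, `r_k = r_{k₁}` and `b k i = 0` for every boundary letter `i`,
for all `k ≥ k₁`. [OURS] [cite: HauserPerlega2019PRIMS, §2 (transform D' of D)] -/
theorem boundary_frozen (q : ℕ) {c : ℕ → State K} {j : ℕ → Fin 4} {b : ℕ → Fin 4 → K}
    (hw : FreeTail.IsWitnessedChain q c j b) {k₁ D : ℕ}
    (ho : ∀ k, k₁ ≤ k → ordZero (c k).F = ((q + 1 : ℕ) : ℕ∞)) (hdeg : ∀ k, k₁ ≤ k → (c k).r.degree = D)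
    (hwt : ∀ k, k₁ ≤ k → ∀ i, (c k).r i ≤ 1) (hslot : ∀ k, k₁ ≤ k → 1 ≤ (c k).r (j k)) :
    ∀ k, k₁ ≤ k → (c k).r = (c k₁).r ∧ ∀ i, (c k₁).r i ≠ 0 → b k i = 0 := by
  have hstep : ∀ k, k₁ ≤ k → (c (k + 1)).r = (c k).r ∧ ∀ i, (c k).r i ≠ 0 → b k i = 0 := fun k hk =>
    r_succ_eq_of_slot q hw (ho k hk) (by rw [hdeg k hk, hdeg (k + 1) (by omega)])
      (le_antisymm (hwt k hk (j k)) (hslot k hk))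
  intro k hk
  induction k, hk using Nat.le_induction with
  | base => exact ⟨rfl, (hstep k₁ le_rfl).2⟩
  | succ k hk ih =>
    have h1 : (c (k + 1)).r = (c k₁).r := by rw [(hstep k hk).1, ih.1]
    have h2 := (hstep (k + 1) (by omega)).2
    rw [h1] at h2
    exact ⟨h1, h2⟩

end Frozen

/-! ## 2. The four letters -/

/-- **A weight-`1` boundary of size `3` through `ν` is `e_A + e_B + e_ν`** for slot letters `A ≠ B` and a free letter
`f`, the four letters pairwise distinct. [folklore] -/
theorem exists_slot_letters {r : Fin 4 →₀ ℕ} (h1 : ∀ i, r i ≤ 1) (hdeg : r.degree = 3) {ν : Fin 4}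
    (hν : r ν = 1) :
    ∃ A B f : Fin 4, A ≠ B ∧ A ≠ ν ∧ A ≠ f ∧ B ≠ ν ∧ B ≠ f ∧ ν ≠ f ∧
      r = Finsupp.single A 1 + Finsupp.single B 1 + Finsupp.single ν 1 := by
  classical
  have hsum : r.degree = r 0 + r 1 + r 2 + r 3 := by rw [Finsupp.degree_eq_sum, Fin.sum_univ_four]
  -- a free letter
  obtain ⟨f, hf⟩ : ∃ f, r f = 0 := by
    by_contra hno
    push Not at hno
    have h0 := Nat.one_le_iff_ne_zero.mpr (hno 0); have h1' := Nat.one_le_iff_ne_zero.mpr (hno 1)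
    have h2 := Nat.one_le_iff_ne_zero.mpr (hno 2); have h3 := Nat.one_le_iff_ne_zero.mpr (hno 3)
    omega
  have hνf : ν ≠ f := fun h => by rw [h, hf] at hν; exact absurd hν (by norm_num)
  -- the two slot letters
  have hcard : ((Finset.univ.erase ν).erase f).card = 2 := by
    rw [Finset.card_erase_of_mem (Finset.mem_erase.mpr ⟨hνf.symm, Finset.mem_univ f⟩),
      Finset.card_erase_of_mem (Finset.mem_univ ν), Finset.card_univ, Fintype.card_fin]
  obtain ⟨A, B, hAB, hset⟩ := Finset.card_eq_two.mp hcard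
  have hA : A ∈ (Finset.univ.erase ν).erase f := by rw [hset]; simp
  have hB : B ∈ (Finset.univ.erase ν).erase f := by rw [hset]; simp
  simp only [Finset.mem_erase, Finset.mem_univ, and_true] at hA hB
  obtain ⟨hAf, hAν⟩ := hA
  obtain ⟨hBf, hBν⟩ := hB
  have hr4 := eq_sum_single_four hAB hAν hAf hBν hBf hνf r
  have hdeg4 : r.degree = r A + r B + r ν + r f := by
    conv_lhs => rw [hr4]
    exact degree_quad A B ν f _ _ _ _
  have hA1 : r A = 1 := by have := h1 A; have := h1 B; omega
  have hB1 : r B = 1 := by have := h1 A; have := h1 B; omega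
  refine ⟨A, B, f, hAB, hAν, hAf, hBν, hBf, hνf, ?_⟩
  conv_lhs => rw [hr4]
  rw [hA1, hB1, hν, hf, Finsupp.single_zero, add_zero]

/-- **Every chart of a slot tail is a slot letter**: with `r = e_A + e_B + e_ν` frozen from `k₁` on, `1 ≤ r (j k)` and
`j k ≠ ν`, the chart is `A` or `B`. [folklore] -/
theorem chart_mem_slots {A B ν f : Fin 4} (hAB : A ≠ B) (hAν : A ≠ ν) (hAf : A ≠ f) (hBν : B ≠ ν) (hBf : B ≠ f)
    (hνf : ν ≠ f) {r : Fin 4 →₀ ℕ} (hr : r = Finsupp.single A 1 + Finsupp.single B 1 + Finsupp.single ν 1)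
    {i : Fin 4} (hslot : 1 ≤ r i) (hiν : i ≠ ν) : i = A ∨ i = B := by
  rcases letters_exhaust hAB hAν hAf hBν hBf hνf i with h | h | h | h
  · exact Or.inl h
  · exact Or.inr h
  · exact absurd h hiν
  · subst h
    rw [hr] at hslot
    simp [hAf, hBf, hνf] at hslot

/-- **Every translation of a slot tail is along the free letter**: if `b i = 0` for every boundary letter of
`r = e_A + e_B + e_ν` then `b = β·e_f`, `β = b f`. [folklore] -/
theorem translation_eq_single {A B ν f : Fin 4} (hAB : A ≠ B) (hAν : A ≠ ν) (hAf : A ≠ f) (hBν : B ≠ ν)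
    (hBf : B ≠ f) (hνf : ν ≠ f) {r : Fin 4 →₀ ℕ}
    (hr : r = Finsupp.single A 1 + Finsupp.single B 1 + Finsupp.single ν 1) {b : Fin 4 → K}
    (hb : ∀ i, r i ≠ 0 → b i = 0) : b = Pi.single f (b f) := by
  funext i
  rcases letters_exhaust hAB hAν hAf hBν hBf hνf i with h | h | h | h
  · subst h; rw [Pi.single_eq_of_ne hAf, hb _ (by rw [hr]; simp [hAB, hAν])]
  · subst h; rw [Pi.single_eq_of_ne hBf, hb _ (by rw [hr]; simp [hAB.symm, hBν])]
  · subst h; rw [Pi.single_eq_of_ne hνf, hb _ (by rw [hr]; simp [hAν.symm, hBν.symm])]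
  · subst h; rw [Pi.single_eq_same]

/-! ## 3. The T-sector persists; the direction equation -/

/-- **THE T-SECTOR PERSISTS**: if the vertex form propagates off the chart letter (`ℓ_{k+1} i = λ_k ℓ_k i`, `λ_k ≠ 0`)
and `f` is never the chart from `k₁` on, then `ℓ_{k₁} f ≠ 0` gives `ℓ_k f ≠ 0` for all `k ≥ k₁`. [folklore] -/
theorem tSector_persists {j : ℕ → Fin 4} {ℓ : ℕ → Fin 4 → K} {lam : ℕ → K} {k₀ k₁ : ℕ} (hk₁ : k₀ ≤ k₁)
    (hlam : ∀ k, k₀ ≤ k → lam k ≠ 0) (hprop : ∀ k, k₀ ≤ k → ∀ i, i ≠ j k → ℓ (k + 1) i = lam k * ℓ k i)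
    {f : Fin 4} (hjf : ∀ k, k₁ ≤ k → j k ≠ f) (hT : ℓ k₁ f ≠ 0) : ∀ k, k₁ ≤ k → ℓ k f ≠ 0 := by
  intro k hk
  induction k, hk using Nat.le_induction with
  | base => exact hT
  | succ k hk ih =>
    rw [hprop k (by omega) f (hjf k hk).symm]
    exact mul_ne_zero (hlam k (by omega)) ih

/-- **The direction equation along the free letter**: `ℓ (j) + ℓ ⬝ (β·e_f) = 0` with `ℓ f ≠ 0` reads
`β = −ℓ (j) / ℓ f`. [folklore] -/
theorem translation_eq_neg_div {ℓ : Fin 4 → K} {κ f : Fin 4} {β : K} (hℓf : ℓ f ≠ 0)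
    (hdir : ℓ κ + dotProduct ℓ (Pi.single f β) = 0) : β = -(ℓ κ / ℓ f) := by
  rw [dotProduct_single] at hdir
  field_simp
  linear_combination hdir

end ResCone

end Summit.ResolutionOfSingularities.ResolutionOfSingularities.Theorems.PIDim4

end
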